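import Summits.NavierStokesRegularity.FluidComputer.ClayBlowupRows
import HarnessLib

/-!
# The enstrophy of a Clay blow-up DIVERGES at the lifespan (not merely unbounded)

Cell `ns-blowup`, seat `ns-blowup-ecbridge-2` (g5; the E–C endpoint theory seat). LABEL: E–C typing
(KERNEL — no named fact). WHAT THIS IS NOT: not Navier–Stokes evidence — a necessary condition on
the TYPE `ClayBlowup` (no inhabitant is claimed anywhere). Companion memo:
`run/shared/lean/pub/ns-blowup/ecbridge2/ECBRIDGE-2-MEMO-4.md`.

## Content

`ClayBlowupRows.lean` gives Leray's `H¹` rate `ClayBlowup.enstrophy_rate`: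
`min(1, cν³/(√((E + ∫|∇u(t)|²).toReal) + B + 1)⁴) ≤ T − t` on `[0, T)`. Read backwards it is a
DIVERGENCE statement, which is the shape refuters test («no oscillating enstrophy»):

* **`ClayBlowup.enstrophy_eventually_gt`** — for every `M` there is `t₀ < T` with `∫|∇u(t)|² > M`
  for ALL `t ∈ (t₀, T)` (`ν > 0`; no named fact, no pressure hypothesis): the enstrophy tends to
  `+∞` at the lifespan;
* `DesignedBlowup.enstrophy_eventually_gt` — the same on the strong type.

References: J. Leray, Acta Math. 63 (1934), (3.16) [cite: Leray1934, (3.16)]; T. Tao, Anal. PDE 6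
(2013), Thm. 5.4 [cite: Tao2011, Thm. 5.4 (ii)+(iv)].
-/

noncomputable section

namespace Summit.NavierStokesRegularity.FluidComputer

open Set MeasureTheory Filter Topology Function
open scoped ENNReal ContDiff NNReal
open Literature.Analysis.FluidPDE

/-- **From Leray's rate to divergence** (pure bookkeeping): if `min(1, κ/(√((E + K t).toReal) + B + 1)⁴)
≤ T − t` for all `t ∈ [0, T)` with `κ > 0`, `E < ⊤`, then for every `M` the quantity `K t` exceeds
`M` on a whole left neighbourhood `(t₀, T)` of `T`. [cite: Leray1934, (3.16)] -/
theorem eventually_gt_of_rate {T κ B : ℝ} (hT : 0 < T) (hκ : 0 < κ) (hB : 0 ≤ B) {E : ℝ≥0∞}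
    (hE : E < ⊤) {K : ℝ → ℝ≥0∞}
    (hrate : ∀ t ∈ Ico 0 T, min 1 (κ / (Real.sqrt (E + K t).toReal + B + 1) ^ 4) ≤ T - t)
    (M : ℝ≥0) : ∃ t₀ < T, ∀ t ∈ Ioo t₀ T, (M : ℝ≥0∞) < K t := by
  set δ : ℝ := min 1 (κ / (Real.sqrt (E + M).toReal + B + 1) ^ 4) with hδ
  have hδ0 : 0 < δ := lt_min one_pos (by positivity)
  refine ⟨max 0 (T - δ), max_lt hT (by linarith), fun t ht => ?_⟩
  have ht0 : 0 ≤ t := (le_max_left _ _).trans ht.1.le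
  have htδ : T - t < δ := by
    have := (le_max_right 0 (T - δ)).trans_lt ht.1
    linarith
  by_contra hle
  rw [not_lt] at hle
  -- with `K t ≤ M` the rate at `t` is at least `δ`
  have hEK : (E + K t).toReal ≤ (E + M).toReal :=
    ENNReal.toReal_mono (ENNReal.add_lt_top.2 ⟨hE, ENNReal.coe_lt_top⟩).ne (add_le_add le_rfl hle)
  have hsq : Real.sqrt (E + K t).toReal + B + 1 ≤ Real.sqrt (E + M).toReal + B + 1 := by
    linarith [Real.sqrt_le_sqrt hEK]
  have hpos : 0 < Real.sqrt (E + K t).toReal + B + 1 := by positivity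
  have hdiv : κ / (Real.sqrt (E + M).toReal + B + 1) ^ 4 ≤
      κ / (Real.sqrt (E + K t).toReal + B + 1) ^ 4 :=
    div_le_div_of_nonneg_left hκ.le (by positivity) (pow_le_pow_left₀ hpos.le hsq 4)
  have hmin : δ ≤ min 1 (κ / (Real.sqrt (E + K t).toReal + B + 1) ^ 4) := by
    rw [hδ]; exact min_le_min le_rfl hdiv
  linarith [hrate t ⟨ht0, ht.2⟩]

namespace ClayBlowup

variable {ν : ℝ} (X : ClayBlowup ν)

/-- **THE ENSTROPHY OF A CLAY BLOW-UP TENDS TO `+∞` AT THE LIFESPAN** (`ν > 0`; no named fact, no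
pressure hypothesis): for every `M` there is `t₀ < T` with `∫|∇u(t)|² > M` for ALL `t ∈ (t₀, T)`.
(Leray's `H¹` rate `enstrophy_rate`, read backwards.) [cite: Leray1934, (3.16)]
[cite: Tao2011, Thm. 5.4 (ii)+(iv)] -/
theorem enstrophy_eventually_gt (hν : 0 < ν) (M : ℝ≥0) :
    ∃ t₀ < X.T, ∀ t ∈ Ioo t₀ X.T,
      (M : ℝ≥0∞) < ∫⁻ x, ENNReal.ofReal (frobeniusNormSq (fderiv ℝ (X.u t) x)) := by
  obtain ⟨c, hc, B, hB, E, hEt, hrate⟩ := X.enstrophy_rate hν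
  exact eventually_gt_of_rate X.T_pos (by positivity) hB hEt hrate M

/-- Filter form: the enstrophy tends to `⊤` in `ℝ≥0∞` along `t ↑ T`. [cite: Leray1934, (3.16)] -/
theorem tendsto_enstrophy_top (hν : 0 < ν) :
    Tendsto (fun t => ∫⁻ x, ENNReal.ofReal (frobeniusNormSq (fderiv ℝ (X.u t) x)))
      (𝓝[<] X.T) (𝓝 ⊤) := by
  refine ENNReal.tendsto_nhds_top_iff_nnreal.2 fun M => ?_
  obtain ⟨t₀, ht₀, h⟩ := X.enstrophy_eventually_gt hν M
  filter_upwards [Ioo_mem_nhdsLT ht₀] with t ht using h t ht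

end ClayBlowup

namespace DesignedBlowup

variable {ν : ℝ} (D : DesignedBlowup ν)

/-- **The enstrophy of a designed forced blow-up tends to `+∞` at the blow-up time** (`ν > 0`; no
named fact): for every `M` some `t₀ < T` has `∫|∇u(t)|² > M` for all `t ∈ (t₀, T)`.
[cite: Leray1934, (3.16)] -/
theorem enstrophy_eventually_gt (hν : 0 < ν) (M : ℝ≥0) :
    ∃ t₀ < D.T, ∀ t ∈ Ioo t₀ D.T,
      (M : ℝ≥0∞) < ∫⁻ x, ENNReal.ofReal (frobeniusNormSq (fderiv ℝ (D.u t) x)) :=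
  D.toClayBlowup.enstrophy_eventually_gt hν M

/-- Filter form on the strong type. [cite: Leray1934, (3.16)] -/
theorem tendsto_enstrophy_top (hν : 0 < ν) :
    Tendsto (fun t => ∫⁻ x, ENNReal.ofReal (frobeniusNormSq (fderiv ℝ (D.u t) x)))
      (𝓝[<] D.T) (𝓝 ⊤) :=
  D.toClayBlowup.tendsto_enstrophy_top hν

end DesignedBlowup

end Summit.NavierStokesRegularity.FluidComputer

end
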